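import Mathlib.LinearAlgebra.ExteriorAlgebra.Basis
import Mathlib.RingTheory.Nilpotent.Exp
import Mathlib.LinearAlgebra.Matrix.Determinant.Basic
import Mathlib.LinearAlgebra.Matrix.Kronecker
import Mathlib.LinearAlgebra.Matrix.Hermitian
import Mathlib.MeasureTheory.Constructions.BorelSpace.Basic
import Literature.MathematicalPhysics.QuantumFieldTheory.ConstructiveQFTWave0
import Literature.MathematicalPhysics.QuantumLattice.GaugeGroups
import Literature.MathematicalPhysics.QuantumLattice.SpinOperators
import Literature.Probability.LatticeModels.LatticeGraph
import HarnessLib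

-- provenance: harness21/H21/H21/Prelude/QLatticeAQFT/GrassmannIntegral.lean @ 3db9903 (interim HEAD d8f2665); M5 mechanical rewrite
/-!
# Berezin integration on Grassmann algebras and lattice Dirac operators
(trunk QLatticeAQFT, item A12 / outline A-D6)

## Content

* **Grassmann algebras.** `GrassmannAlgebra R ι := ExteriorAlgebra R (ι → R)`, the free
  graded-commutative `R`-algebra on generators `θᵢ = GrassmannAlgebra.gen R i`, `i : ι`.  For a
  finite linearly ordered `ι` Mathlib's `Module.Basis.ExteriorAlgebra` gives the monomial basis
  `grassmannBasis R ι : Basis (Finset ι) R _`, `s ↦ θ_{i₁} ⋯ θ_{iₖ}` (`i₁ < ⋯ < iₖ` the elements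
  of `s`, increasing product, `ExteriorAlgebra.ιMulti_family`).
* **Berezin integral.** `berezin : GrassmannAlgebra R ι →ₗ[R] R` is the top coordinate
  `(grassmannBasis R ι).coord univ`; orientation convention: `∫ dθ (θ_{i₁} θ_{i₂} ⋯ θ_{iₙ}) = 1` for
  the *increasing* product of all generators (`berezin_prod_gen`).  `berezinOn s` integrates out
  the variables in `s ⊆ ι` only (integrated block moved to the right, sign `berezinSign`).
  `grassmannExp := IsNilpotent.exp` (a finite sum on the nilpotent even part).
* **Complex fermions / Gaussian Berezin integrals.** On `ι ⊕ₗ ι` (lexicographic sum, all `ψ̄`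
  before all `ψ`): `psiBar i`, `psi i`, `quadratic A = Σᵢⱼ Aᵢⱼ ψ̄ᵢ ψⱼ` and the Gaussian formula
  `berezin (exp (quadratic A)) = (-1)^{n(n-1)/2} det A` (`berezin_grassmannExp_quadratic`; the
  sign is forced by our orientation `ψ̄₁⋯ψ̄ₙψ₁⋯ψₙ ↦ 1` and is computed in the docstring).
* **Lattice fermions on the discrete torus** `TorusSite d L = (ℤ/Lℤ)^d` (from
  `Literature.Prelude.StatMech.LatticeGraph`; definitionally `ConstructiveQFT.Site d L`) coupled to a
  gauge field `U : ConstructiveQFT.GaugeConfig d L G` through a representation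
  `ρ : G →* Matrix (Fin N) (Fin N) ℂ`: staggered phases `staggeredPhase`, the staggered
  (Kogut–Susskind) operator `staggeredDirac`, Euclidean gamma matrices `euclideanGamma` in the
  chiral basis (Kronecker products of the Pauli matrices `QLattice.spinHalfPauli`), `gammaFive`,
  the Wilson–Dirac operator `wilsonDirac`, `fermionDet := Matrix.det`, γ₅-hermiticity, and the
  compact lattice QED weight/measure `qedLatticeWeight`, `qedLatticeMeasure` (Wilson gauge weight
  for `U(1) = Circle` times `|det D_W|^{N_f}`).

## Sources

F. A. Berezin, *The Method of Second Quantization* (Academic Press, 1966), Ch. I §3;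
I. Montvay, G. Münster, *Quantum Fields on a Lattice* (CUP, 1994): §4.1 (Grassmann variables and
integration, eqs. (4.13)–(4.25)); §4.2 (free Wilson fermions: the action and fermion matrix
§4.2.2 (4.84)–(4.89), reflection positivity §4.2.3); §4.3.1 (staggered fermions: the phase
`α_{xμ}` (4.158) and the free staggered action (4.166)); §5.1.1 (lattice QCD actions: Wilson
quarks (5.5), staggered quarks (5.7)); Appendix §8.1.2 (Euclidean γ matrices, "App. A" below).
The link-orientation convention of `staggeredDirac` and `wilsonDirac` is opposite to the book's
(5.5), (5.7): here `ρ(U(x,μ))` sits on the forward hop `ψ̄_x ⋯ ψ_{x+μ̂}` (there `U⁺_{xμ}`), i.e.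
`U_{xμ} ↦ U_{xμ}⁻¹` linkwise, which is immaterial for the facts stated in this file (all quantify
over every `U`);
E. Seiler, *Gauge Theories as a Problem of Constructive Quantum Field Theory and Statistical
Mechanics*, LNP 159 (Springer, 1982), Ch. 3.

## Mathlib status and design choices

* Mathlib has `ExteriorAlgebra`, `ExteriorAlgebra.ι`, `Module.Basis.ExteriorAlgebra`,
  `Module.Basis.coord`, `IsNilpotent.exp`, `Matrix.det`, `Matrix.kroneckerMap`; it has no
  Berezin integral, no Grassmann Gaussian formula, no gamma matrices and no lattice Dirac
  operators (grep `Berezin`, `Grassmann`, `gamma`, `Dirac` in `Mathlib/`).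
* `IsNilpotent.exp` needs `[Module ℚ _]`; we assume `[Algebra ℚ R]`, which induces the instance
  on `ExteriorAlgebra R (ι → R)` through `CliffordAlgebra.instAlgebra'`.
* Complex fermions are indexed by the *lexicographic* sum `ι ⊕ₗ ι` because Mathlib's order on the
  plain sum `ι ⊕ ι` is not linear.
* `staggeredPhase` uses `ZMod.val`, i.e. the representative in `[0, L)`; the phases are
  translation covariant on the torus only for `Even L` (or `L = 0`, the infinite lattice, where
  `ZMod 0 = ℤ` and `val = natAbs` is a junk convention for negative coordinates).
* Mathlib has no `MeasurableSpace Circle`; we register the Borel σ-algebra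
  (`Circle.instMeasurableSpace`, `Circle.instBorelSpace`, deliberate additions in the `Circle`
  namespace, duplicating no Mathlib instance) so that the Wave0 Wilson weight applies to
  `G = U(1)`.
* The non-compact lattice `U(1)` theory (Gaussian measure on `ℝ`-valued link variables with the
  action `β/2 Σₚ (dA)ₚ²`) is *not* formalised here; only the compact Wilson version is.
-/

noncomputable section

open Finset Matrix Complex MeasureTheory
open scoped Kronecker

/-! ### Borel structure on the circle group -/

namespace Circle

/-- The Borel σ-algebra on `U(1) = Circle`.  Not in Mathlib at the pin (`Circle` is a `def`, so
the subtype instance does not apply); deliberate addition to the `Circle` namespace. [folklore] -/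
instance instMeasurableSpace : MeasurableSpace Circle := borel Circle

/-- `Circle` with `Circle.instMeasurableSpace` is a Borel space (by definition). [folklore] -/
instance instBorelSpace : BorelSpace Circle := ⟨rfl⟩

end Circle

namespace Literature.MathematicalPhysics.QuantumLattice

section QLatticeAQFT

/-! ### Grassmann algebras and the Berezin integral -/

/-- The Grassmann algebra over `R` on generators indexed by `ι`: the exterior algebra of the free
module `ι → R` (Berezin 1966, Ch. I §3). [cite: Berezin1966, Ch. I §3] -/
abbrev GrassmannAlgebra (R : Type*) (ι : Type*) [CommRing R] : Type _ :=
  ExteriorAlgebra R (ι → R)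

namespace GrassmannAlgebra

variable (R : Type*) [CommRing R] {ι : Type*}

/-- The generator `θᵢ` of the Grassmann algebra: the image of the basis vector `eᵢ` under
`ExteriorAlgebra.ι` (Berezin 1966, Ch. I §3). [cite: Berezin1966, Ch. I §3] -/
def gen [DecidableEq ι] (i : ι) : GrassmannAlgebra R ι :=
  ExteriorAlgebra.ι R (Pi.single i 1)

/-- Generators square to zero: `θᵢ² = 0` (Berezin 1966, (3.1)). [cite: Berezin1966, (3.1] -/
@[simp] theorem gen_mul_self [DecidableEq ι] (i : ι) : gen R i * gen R i = 0 :=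
  ExteriorAlgebra.ι_sq_zero _

/-- Generators anticommute: `θᵢ θⱼ = - θⱼ θᵢ` (Berezin 1966, (3.1)). [cite: Berezin1966, (3.1] -/
theorem gen_mul_gen [DecidableEq ι] (i j : ι) : gen R i * gen R j = -(gen R j * gen R i) :=
  eq_neg_of_add_eq_zero_left (ExteriorAlgebra.ι_add_mul_swap _ _)

variable (ι) in
/-- The monomial basis of the Grassmann algebra on a finite linearly ordered set of generators:
`s ↦ θ_{i₁} θ_{i₂} ⋯ θ_{iₖ}` where `i₁ < i₂ < ⋯ < iₖ` enumerate `s : Finset ι` increasingly.  This is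
Mathlib's `Module.Basis.ExteriorAlgebra` of the standard basis `Pi.basisFun R ι`
(Berezin 1966, Ch. I §3, (3.3)). [cite: Berezin1966, Ch. I §3  (3.3] -/
def grassmannBasis [LinearOrder ι] [Fintype ι] : Module.Basis (Finset ι) R (GrassmannAlgebra R ι) :=
  (Pi.basisFun R ι).ExteriorAlgebra

variable (ι) in
/-- The Berezin integral `∫ dθ : Λ(θ) → R`: the coefficient of the top monomial
`θ_{i₁} ⋯ θ_{iₙ}` (increasing product of *all* generators) in the monomial basis.  Orientation
convention: `∫ dθ θ_{i₁} ⋯ θ_{iₙ} = 1` for `i₁ < ⋯ < iₙ`, all lower monomials integrate to `0`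
(Berezin 1966, Ch. I §3, (3.4)–(3.5); Montvay–Münster §4.1). [cite: Berezin1966, Ch. I §3  (3.4] -/
def berezin [LinearOrder ι] [Fintype ι] : GrassmannAlgebra R ι →ₗ[R] R :=
  (grassmannBasis R ι).coord Finset.univ

/-- The Berezin integral of the top basis monomial is `1` (Berezin 1966, (3.5)). [cite: Berezin1966, (3.5] -/
@[simp] theorem berezin_grassmannBasis_univ [LinearOrder ι] [Fintype ι] :
    berezin R ι (grassmannBasis R ι Finset.univ) = 1 := by
  simp [berezin]

/-- The Berezin integral of a non-top basis monomial vanishes (Berezin 1966, (3.4)). [cite: Berezin1966, (3.4] -/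
theorem berezin_grassmannBasis_of_ne [LinearOrder ι] [Fintype ι] {s : Finset ι}
    (hs : s ≠ Finset.univ) : berezin R ι (grassmannBasis R ι s) = 0 := by
  simp [berezin, Finsupp.single_eq_of_ne' hs]

/-- The Berezin integral of the increasing product of all generators is `1`:
`∫ dθ θ_{i₁} θ_{i₂} ⋯ θ_{iₙ} = 1` (Berezin 1966, (3.5)). [cite: Berezin1966, (3.5] -/
def berezin_prod_gen : Prop :=
  ∀ [LinearOrder ι] [Fintype ι],
    berezin R ι (((Finset.univ : Finset ι).sort).map (gen R)).prod = 1

/-- The sign picked up when the variables of `s` are moved, as an increasing block, to the right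
of the remaining variables of the monomial `θ_t` (`s ⊆ t`):
`θ_t = berezinSign s t • θ_{t \ s} θ_s`, i.e. `(-1)^{#{(a, b) ∈ s × (t \ s) | a < b}}`. [folklore] -/
def berezinSign [LinearOrder ι] (s t : Finset ι) : ℤˣ :=
  (-1) ^ ((s ×ˢ (t \ s)).filter fun p => p.1 < p.2).card

variable [LinearOrder ι] [Fintype ι]

/-- Partial Berezin integration `∫ ∏_{i ∈ s} dθᵢ` over the variables in `s : Finset ι`, an
`R`-linear endomorphism of the Grassmann algebra: on monomials, `θ_t ↦ 0` unless `s ⊆ t`, and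
`θ_t = ε θ_{t∖s} θ_s ↦ ε θ_{t∖s}` (`ε = berezinSign s t`; the integrated block is moved to the
right, consistent with `berezin = berezinOn univ`, `berezinOn_univ`)
(Berezin 1966, Ch. I §3; Montvay–Münster §4.1). [cite: Berezin1966, Ch. I §3] -/
def berezinOn (s : Finset ι) : GrassmannAlgebra R ι →ₗ[R] GrassmannAlgebra R ι :=
  (grassmannBasis R ι).constr R fun t =>
    if s ⊆ t then ((berezinSign s t : ℤ) : R) • grassmannBasis R ι (t \ s) else 0

/-- Integrating out all variables is the Berezin integral (as a scalar):
`berezinOn univ a = (∫ dθ a) • 1`. [cite: BerezinSecondQuant1966, Ch. I §3 (Berezin integral over all generators); definitional, pending proof] -/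
def berezinOn_univ : Prop :=
  ∀ (a : GrassmannAlgebra R ι),
    berezinOn R Finset.univ a = algebraMap R (GrassmannAlgebra R ι) (berezin R ι a)

/-- Partial Berezin integration on monomials: `∫ dθ_s θ_t = ε θ_{t∖s}` if `s ⊆ t` and `0`
otherwise (Berezin 1966, Ch. I §3, (3.4)–(3.5)). [cite: Berezin1966, Ch. I §3  (3.4] -/
theorem berezinOn_grassmannBasis (s t : Finset ι) :
    berezinOn R s (grassmannBasis R ι t) =
      if s ⊆ t then ((berezinSign s t : ℤ) : R) • grassmannBasis R ι (t \ s) else 0 := by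
  rw [berezinOn, Module.Basis.constr_basis]

end GrassmannAlgebra

open GrassmannAlgebra

/-- The exponential of an element of the Grassmann algebra, `exp a = Σₖ aᵏ/k!`, a finite sum for
nilpotent `a` (in particular for every element without constant term); Mathlib's
`IsNilpotent.exp` (junk value for non-nilpotent `a`) (Berezin 1966, Ch. I §3). [cite: Berezin1966, Ch. I §3] -/
def grassmannExp {R : Type*} [CommRing R] [Algebra ℚ R] {ι : Type*} (a : GrassmannAlgebra R ι) :
    GrassmannAlgebra R ι :=
  IsNilpotent.exp a

/-! ### Complex fermions and Gaussian Berezin integrals -/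

section ComplexFermions

variable (R : Type*) [CommRing R] {ι : Type*} [DecidableEq ι]

/-- The conjugate fermion generator `ψ̄ᵢ`, the generator indexed by `inl i` of the Grassmann
algebra on `ι ⊕ₗ ι` (Montvay–Münster §4.1). [folklore] -/
def psiBar (i : ι) : GrassmannAlgebra R (ι ⊕ₗ ι) :=
  gen R (toLex (Sum.inl i))

/-- The fermion generator `ψᵢ`, the generator indexed by `inr i` of the Grassmann algebra on
`ι ⊕ₗ ι` (Montvay–Münster §4.1). [folklore] -/
def psi (i : ι) : GrassmannAlgebra R (ι ⊕ₗ ι) :=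
  gen R (toLex (Sum.inr i))

variable [Fintype ι]

/-- The fermionic bilinear (quadratic action) `ψ̄ A ψ = Σᵢⱼ Aᵢⱼ ψ̄ᵢ ψⱼ` of a matrix `A`
(Montvay–Münster §4.1, (4.14)). [folklore] -/
def quadratic (A : Matrix ι ι R) : GrassmannAlgebra R (ι ⊕ₗ ι) :=
  ∑ i, ∑ j, A i j • (psiBar R i * psi R j)

/-- **Gaussian Berezin integral** (Berezin 1966, Ch. I §3, Thm. 3.1; Montvay–Münster §4.1,
(4.17)): `∫ dψ̄ dψ exp(Σᵢⱼ Aᵢⱼ ψ̄ᵢ ψⱼ) = (-1)^{n(n-1)/2} det A`, `n = |ι|`.  The sign is forced by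
the orientation `berezin (ψ̄₁ ⋯ ψ̄ₙ ψ₁ ⋯ ψₙ) = 1` (`ψ̄` before `ψ` in `ι ⊕ₗ ι`): the top term of
the exponential is `Σ_σ ∏ᵢ A_{i σ i} ψ̄₁ψ_{σ1} ⋯ ψ̄ₙψ_{σn}`, and moving each `ψ̄ₖ` left past `k - 1`
factors `ψ` costs `(-1)^{0 + 1 + ⋯ + (n-1)}`, after which `ψ_{σ1}⋯ψ_{σn} = sign σ • ψ₁⋯ψₙ`. [cite: Berezin1966, Ch. I §3  Thm. 3.1] -/
def berezin_grassmannExp_quadratic : Prop :=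
  ∀ [Algebra ℚ R] [LinearOrder ι] (A : Matrix ι ι R),
    berezin R (ι ⊕ₗ ι) (grassmannExp (quadratic R A)) =
      (-1 : R) ^ (Fintype.card ι * (Fintype.card ι - 1) / 2) * A.det

end ComplexFermions

/-! ### Lattice fermions on the discrete torus -/

section LatticeFermions

open Literature.Probability.LatticeModels QuantumFieldTheory

variable {d L N : ℕ} {G : Type*} [Group G]

/-- The staggered (Kawamoto–Smit) phase `η_μ(x) = (-1)^{x₀ + ⋯ + x_{μ-1}}` of the site `x` of the
torus `(ℤ/Lℤ)^d` in direction `μ`, with coordinates read through `ZMod.val ∈ [0, L)`.  These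
phases are periodic (well defined on the torus) iff `L` is even; for odd `L` the definition is
the usual junk convention, and for `L = 0` (`ZMod 0 = ℤ`) `val = natAbs`
(Montvay–Münster §4.3.1, (4.158): `α_{xμ} = (-1)^{x_1 + ⋯ + x_{μ-1}}`, coordinates numbered from
`1` there and from `0` here). [folklore] -/
def staggeredPhase (x : TorusSite d L) (μ : Fin d) : ℤˣ :=
  (-1) ^ (∑ ν ∈ Finset.univ.filter (· < μ), (x ν).val)

variable (ρ : G →* Matrix (Fin N) (Fin N) ℂ)

/-- The gauge-covariant staggered (Kogut–Susskind) Dirac operator on the torus with colour index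
`Fin N`: `D_{(x,a),(y,b)} = m δ_{xy} δ_{ab} + ½ Σ_μ η_μ(x) (ρ(U(x,μ))_{ab} δ_{y,x+μ̂}
- ρ(U(y,μ)⁻¹)_{ab} δ_{x,y+μ̂})`, the matrix of the staggered quark action
`Σ_x { am (ψ̄_x ψ_x) + ½ Σ_μ α_{xμ} [(ψ̄_x U⁺_{xμ} ψ_{x+μ̂}) - (ψ̄_{x+μ̂} U_{xμ} ψ_x)] }`
(Montvay–Münster §5.1.1, (5.7), normalisation `K = ½`; free case §4.3.1, (4.166)) for a general
gauge group `G` and representation `ρ`, in the opposite link-orientation convention: here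
`ρ(U(x,μ))` sits on the forward hop `ψ̄_x ⋯ ψ_{x+μ̂}` and `ρ(U(x,μ))⁻¹` on the backward one, where
(5.7) has `U⁺_{xμ}` and `U_{xμ}` respectively (`U ↦ U⁻¹` linkwise, immaterial for the facts below)
(see also Seiler LNP 159 Ch. 3). [folklore] -/
def staggeredDirac (U : GaugeConfig d L G) (m : ℝ) :
    Matrix (TorusSite d L × Fin N) (TorusSite d L × Fin N) ℂ :=
  Matrix.of fun p q =>
    (if p = q then (m : ℂ) else 0) +
      (1 / 2 : ℂ) * ∑ μ : Fin d, ((staggeredPhase p.1 μ : ℤ) : ℂ) *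
        ((if q.1 = QuantumFieldTheory.Site.shift p.1 μ then ρ (U (p.1, μ)) p.2 q.2 else 0) -
          (if p.1 = QuantumFieldTheory.Site.shift q.1 μ then ρ (U (q.1, μ))⁻¹ p.2 q.2 else 0))

/-- The massless staggered Dirac operator is anti-Hermitian for a unitary representation `ρ`
(`η_μ(x + μ̂) = η_μ(x)` since `η_μ` only involves the coordinates `ν < μ`).  This is the one-line
consequence of the staggered action, Montvay–Münster §5.1.1 (5.7) (gauge covariant, `K = ½`; free
case §4.3.1 (4.166)), with the phase `α_{xμ} = (-1)^{x_1 + ⋯ + x_{μ-1}}` of §4.3.1 (4.158); the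
book does not print it as a numbered statement.  Discharged (all `d`, `L`, `N`, `G`) as
`staggeredDirac_antihermitian_massless_holds` in the sibling `GrassmannIntegralProofs.lean`. [cite: MontvayMunster1994, §5.1.1 (5.7) with §4.3.1 (4.158)] -/
def staggeredDirac_antihermitian_massless : Prop :=
  ∀ (hρ : ∀ g, ρ g ∈ Matrix.unitaryGroup (Fin N) ℂ) (U : GaugeConfig d L G),
    (staggeredDirac ρ U 0)ᴴ = -staggeredDirac ρ U 0

/-- The Euclidean gamma matrices `γ_μ`, `μ : Fin 4`, in the chiral basis, as Kronecker products of
Pauli matrices: `γ_k = σʸ ⊗ σ^k` (`k = 0, 1, 2` for `σˣ, σʸ, σᶻ`) and `γ₃ = σˣ ⊗ 1` (the "time"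
direction last; the `2 × 2` identity is written `!![1, 0; 0, 1]` so that `simp` evaluates
entries), reindexed along `finProdFinEquiv : Fin 2 × Fin 2 ≃ Fin 4`.  They are Hermitian and satisfy
`{γ_μ, γ_ν} = 2 δ_{μν}` (`euclideanGamma_anticomm`) (Montvay–Münster §4.2, (4.31) and App. A). [folklore] -/
def euclideanGamma (μ : Fin 4) : Matrix (Fin 4) (Fin 4) ℂ :=
  Matrix.reindex finProdFinEquiv finProdFinEquiv <|
    if h : (μ : ℕ) < 3 then
      QuantumLattice.spinHalfPauli 1 ⊗ₖ QuantumLattice.spinHalfPauli ⟨μ, h⟩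
    else QuantumLattice.spinHalfPauli 0 ⊗ₖ !![1, 0; 0, 1]

/-- The Euclidean Clifford relations `γ_μ γ_ν + γ_ν γ_μ = 2 δ_{μν} 1`
(Montvay–Münster App. A). [cite: MontvayMunster1994, App. A (Euclidean γ matrices)] -/
def euclideanGamma_anticomm : Prop :=
  ∀ (μ ν : Fin 4),
    euclideanGamma μ * euclideanGamma ν + euclideanGamma ν * euclideanGamma μ =
      if μ = ν then 2 else 0

/-- The Euclidean gamma matrices are Hermitian (Montvay–Münster App. A). [folklore] -/
theorem euclideanGamma_isHermitian (μ : Fin 4) : (euclideanGamma μ).IsHermitian := by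
  fin_cases μ <;>
  · ext i j
    fin_cases i <;> fin_cases j <;>
      simp [euclideanGamma, QuantumLattice.spinHalfPauli, Matrix.kroneckerMap_apply, finProdFinEquiv,
        Fin.divNat, Fin.modNat, Matrix.conjTranspose_apply]

/-- `γ₅ = γ₀ γ₁ γ₂ γ₃`; in the chiral basis this is `σᶻ ⊗ 1 = diag(1, 1, -1, -1)`
(Montvay–Münster App. A). [folklore] -/
def gammaFive : Matrix (Fin 4) (Fin 4) ℂ :=
  euclideanGamma 0 * euclideanGamma 1 * euclideanGamma 2 * euclideanGamma 3

/-- `γ₅` is the chirality matrix `diag(1, 1, -1, -1)` in the chiral basis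
(Montvay–Münster App. A). [folklore] -/
theorem gammaFive_eq_diagonal : gammaFive = Matrix.diagonal ![1, 1, -1, -1] := by
  ext i j
  fin_cases i <;> fin_cases j <;>
    simp [gammaFive, euclideanGamma, QuantumLattice.spinHalfPauli, Matrix.kroneckerMap_apply,
      finProdFinEquiv, Fin.divNat, Fin.modNat, Matrix.mul_apply, Fin.sum_univ_four]

/-- The gauge-covariant Wilson–Dirac operator on the four-dimensional torus with colour index
`Fin N` and spinor index `Fin 4`, Wilson parameter `r` and bare mass `m`:
`(D_W)_{(x,a,α),(y,b,β)} = (m + 4r) δ - ½ Σ_μ [ (r - γ_μ)_{αβ} ρ(U(x,μ))_{ab} δ_{y,x+μ̂}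
+ (r + γ_μ)_{αβ} ρ(U(y,μ)⁻¹)_{ab} δ_{x,y+μ̂} ]`
(Wilson 1975; Montvay–Münster §4.2.2, (4.85) at `a = 1`, i.e. (4.88)–(4.89) with the
hopping-parameter normalisation (4.86)–(4.87) removed, colour-gauged as in §5.1.1 (5.5) in the
opposite link orientation; Seiler LNP 159 Ch. 3). [cite: Wilson1975] -/
def wilsonDirac (U : GaugeConfig 4 L G) (m r : ℝ) :
    Matrix (TorusSite 4 L × Fin N × Fin 4) (TorusSite 4 L × Fin N × Fin 4) ℂ :=
  Matrix.of fun p q =>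
    (if p = q then ((m + 4 * r : ℝ) : ℂ) else 0) -
      (1 / 2 : ℂ) * ∑ μ : Fin 4,
        ((if q.1 = QuantumFieldTheory.Site.shift p.1 μ then
            ((r : ℂ) • (1 : Matrix (Fin 4) (Fin 4) ℂ) - euclideanGamma μ) p.2.2 q.2.2 *
              ρ (U (p.1, μ)) p.2.1 q.2.1 else 0) +
          (if p.1 = QuantumFieldTheory.Site.shift q.1 μ then
            ((r : ℂ) • (1 : Matrix (Fin 4) (Fin 4) ℂ) + euclideanGamma μ) p.2.2 q.2.2 *
              ρ (U (q.1, μ))⁻¹ p.2.1 q.2.1 else 0))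

/-- The fermion determinant `det D` of a lattice Dirac operator, the result of the Gaussian
Berezin integral `∫ dψ̄ dψ exp(-ψ̄ D ψ)` up to the orientation sign
(`berezin_grassmannExp_quadratic`; Montvay–Münster §4.1, (4.17)).  A thin wrapper around
`Matrix.det`. [folklore] -/
abbrev fermionDet {n : Type*} [Fintype n] [DecidableEq n] (D : Matrix n n ℂ) : ℂ := D.det

/-- The spinor matrix `Γ` acting on the spin index only: `1_Λ ⊗ 1_N ⊗ Γ` on
`TorusSite 4 L × Fin N × Fin 4`. [folklore] -/
def spinorLift (Γ : Matrix (Fin 4) (Fin 4) ℂ) :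
    Matrix (TorusSite 4 L × Fin N × Fin 4) (TorusSite 4 L × Fin N × Fin 4) ℂ :=
  (1 : Matrix (TorusSite 4 L) (TorusSite 4 L) ℂ) ⊗ₖ ((1 : Matrix (Fin N) (Fin N) ℂ) ⊗ₖ Γ)

/-- **γ₅-hermiticity of the Wilson–Dirac operator**: `γ₅ D_W γ₅ = D_W†` for a unitary
representation `ρ` (Montvay–Münster §4.2, (4.35)).  Consequently `det D_W` is real. [cite: MontvayMunster1994, §4.2 (4.35)] -/
def wilsonDirac_gammaFive_hermitian : Prop :=
  ∀ [NeZero L] (hρ : ∀ g, ρ g ∈ Matrix.unitaryGroup (Fin N) ℂ) (U : GaugeConfig 4 L G) (m r : ℝ),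
    spinorLift gammaFive * wilsonDirac ρ U m r * spinorLift gammaFive =
      (wilsonDirac ρ U m r)ᴴ

/-- The fermion determinant of the Wilson–Dirac operator is real for unitary `ρ`
(a consequence of γ₅-hermiticity; Montvay–Münster §4.2). [cite: MontvayMunster1994, §4.2 (γ₅-hermiticity ⇒ real determinant)] -/
def fermionDet_wilsonDirac_im : Prop :=
  ∀ [NeZero L] (hρ : ∀ g, ρ g ∈ Matrix.unitaryGroup (Fin N) ℂ) (U : GaugeConfig 4 L G) (m r : ℝ),
    (fermionDet (wilsonDirac ρ U m r)).im = 0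

/-! ### Compact lattice QED -/

/-- The un-normalised compact lattice QED weight on the four-dimensional torus of side `L` with
`N_f` degenerate flavours of Wilson fermions (`r = 1`, bare mass `m`):
`exp(-β S_W(U)) |det D_W(U)|^{N_f} ∏ₑ dU_e`, gauge group `U(1) = Circle` in its defining
representation `u1Rep` (Montvay–Münster §4.2–4.3; Seiler LNP 159 Ch. 3).  The fermions have been
integrated out by the Gaussian Berezin formula; `|det|` is used (for even `N_f` this is
`det^{N_f}` since `det D_W` is real, `fermionDet_wilsonDirac_im`). [folklore] -/
def qedLatticeWeight (L : ℕ) [NeZero L] (β m : ℝ) (Nf : ℕ) :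
    Measure (GaugeConfig 4 L Circle) :=
  (wilsonWeight (d := 4) (L := L) u1Rep β).withDensity fun U =>
    ENNReal.ofReal (‖fermionDet (wilsonDirac u1Rep U m 1)‖ ^ Nf)

/-- The compact lattice QED probability measure `Z⁻¹ exp(-β S_W(U)) |det D_W(U)|^{N_f} ∏ₑ dU_e`
on `U(1)` gauge configurations of the four-torus (Montvay–Münster §4.3; Seiler LNP 159 Ch. 3).
Junk value (the zero measure, `∞⁻¹ = 0`, or a non-probability measure) if the weight has
infinite or zero total mass, which does not happen for `L ≥ 1`.  The non-compact variant
(Gaussian link variables in `ℝ`) is not formalised. [folklore] -/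
def qedLatticeMeasure (L : ℕ) [NeZero L] (β m : ℝ) (Nf : ℕ) :
    Measure (GaugeConfig 4 L Circle) :=
  (qedLatticeWeight L β m Nf Set.univ)⁻¹ • qedLatticeWeight L β m Nf

end LatticeFermions

end QLatticeAQFT

end Literature.MathematicalPhysics.QuantumLattice
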